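import Summits.ValiantsHypothesis.ValiantsHypothesis.Theorems.LacunarySymmetroidMatrixDescartesRangeLaw

/-!
# `MatrixDescartes` — line «profile» ported: the SYMMETRIC PROFILE LAW `|a_r · a_{n−r}| ≥ C(n,r)² · |a_0 · a_n|` for
# full-positive-rooted polynomials, coefficient heights of a pencil determinant through the design's REPRESENTATION
# NUMBERS, the profile law for pencils, the seven per-basis INSTRUMENT rows (54 / 205 / 1848 / 1390 / 1390 / 12259 / 10857)
# and «violating designs are additively rich»

HONEST FRAMING.  Port (director-valiant g11-R94 (b): banked helper port; porter val-port-1; val-idea-crit-1 VERDICT #24 port notes: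
Theorems namespace, reuse `IsFullPosRooted` / `dA*` from `…FiniteSectorDefs`, new defs only `Rrep` + `ProfileRow`) of §2–§8 of the
crux workfile `Cruxes/MatrixDescartes/Lines/profile.lean` (val-idea-6 g4, LINE 2; lens «control» + «assume the law fails»;
val-idea-crit-1 VERDICT #24 = PASS and val-idea-crit-2 VERDICT #27 = PASS, structure + instrument tier, 0 seats; booked with
«range» as one line).  The crux `Summit.ValiantsHypothesis.ValiantsHypothesis.Theses.LacunarySymmetroid.MatrixDescartes`
(`stmt-ValiantsHypothesis-18050`) is asymptotic in `K` and HEIGHT-FREE; everything here is on the FULL sector and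
height-sensitive, so NOTHING here closes the crux, moves a census rung of record, or bears on `VP ≠ VNP`.  Vocabulary by
name: `pencil`, `IsFullPosRooted`, `dA5 … dA8b` (`…FiniteSectorDefs`), `Rrep`, `ProfileRow` (`…FiniteSectorHeightDefs`);
the §1 root bookkeeping (`card_roots_of_fullPos`, `roots_pos_of_fullPos`, `toFinset_card_roots_of_fullPos`,
`roots_eq_toFinset_val_of_fullPos`) is shared BY NAME from the «range» port `…RangeLaw.lean` (namespace `…Range`,
val-port-2), not re-declared.  NOT ported here: the workfile's §0/§6 local copies of the defs and its §1 (cited instead).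

* **§2 symmetric Maclaurin by Cauchy–Schwarz** (`choose_sq_mul_prod_le`): `C(n,r)²·∏S ≤ e_r(S)·e_{n−r}(S)` for `n` positive reals.
* **§3 the symmetric profile law** (`esymm_roots_eq`, `abs_coeff_eq`, `profileLaw_fullPos`): `C(n,r)²·|a_0·a_n| ≤ |a_r·a_{n−r}|`,
  equality at `c(X−1)^n`.
* **§4 coefficient heights see the representation numbers** (`pencil_apply`, `prod_pencil_apply`, `coeff_prod_pencil`,
  `abs_coeff_det_pencil_le`): letters `≤ h` ⇒ `|[t^r] det P| ≤ m!·h^m·R_d^{(m)}(r)`.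
* **§5 the profile law for pencils** (`pencilProfileLaw`; `profileLaw_thin` = the `K`-FREE corollary on thin designs).
* **§6–§7 the row schema lemma and the seven rows** (`profileRow_of`; `profileRow_dA5 / dA6 / dA7a / dA7b / dA7c / dA8a / dA8b`:
  an integer-normalised full `2×2` pencil of the stamp degree on the basis needs a letter `≥ 54 / 205 / 1848 / 1390 / 1390 /
  12259 / 10857`; `Rrep` by `decide`, binomials by `norm_num`; the binding window `(r, R(r), R(n−r))` is named in each docstring).
* **§8 «assume the law fails»** (`design_rich_of_full`): a full format at bounded height forces
  `C(n,r) ≤ m!·h^m·max(R(r), R(n−r))` for all `r ≤ n` — violating designs are additively rich.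
[folklore] throughout (Newton–Maclaurin endpoint case by Cauchy–Schwarz; permutation expansion of `det`; arithmetic).
-/

-- `Summit.ValiantsHypothesis.ValiantsHypothesis.…` repeats a component by the D-0017 layout
-- (single-conjunct summit), which the `dupNamespace` linter flags; the name is mandated.
set_option linter.dupNamespace false

noncomputable section

namespace Summit.ValiantsHypothesis.ValiantsHypothesis.Theorems.LacunarySymmetroidMatrixDescartes.ProfileLaw

open Summit.ValiantsHypothesis.ValiantsHypothesis.Theorems.LacunarySymmetroidMatrixDescartes.FiniteSector
open Summit.ValiantsHypothesis.ValiantsHypothesis.Theorems.LacunarySymmetroidMatrixDescartes.Range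
open scoped BigOperators Matrix
open Polynomial Finset

/-! ## §2 Symmetric Maclaurin by Cauchy–Schwarz: `e_r(S) · e_{n−r}(S) ≥ C(n,r)² · ∏ S` -/

/-- For a finite set `S` of positive reals with `|S| = n` and `r ≤ n`:
`C(n,r)² · ∏_{a∈S} a ≤ (Σ_{|T|=r} ∏_T a) · (Σ_{|U|=n−r} ∏_U a)`.  Cauchy–Schwarz on the pairs `(T, S∖T)`, each of
product `∏ S`. [folklore: the endpoint case of Newton–Maclaurin] -/
theorem choose_sq_mul_prod_le (S : Finset ℝ) (hS : ∀ a ∈ S, 0 < a) {r : ℕ} (hr : r ≤ S.card) :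
    ((S.card.choose r : ℕ) : ℝ) ^ 2 * ∏ a ∈ S, a
      ≤ (∑ T ∈ S.powersetCard r, ∏ a ∈ T, a) * (∑ U ∈ S.powersetCard (S.card - r), ∏ a ∈ U, a) := by
  have hP : 0 < ∏ a ∈ S, a := Finset.prod_pos hS
  -- re-index the second factor by complements
  have hre : (∑ U ∈ S.powersetCard (S.card - r), ∏ a ∈ U, a)
      = ∑ T ∈ S.powersetCard r, ∏ a ∈ S \ T, a := by
    refine (Finset.sum_bij' (fun U _ => S \ U) (fun T _ => S \ T) ?_ ?_ ?_ ?_ ?_).symm <;> try skip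
    · intro U hU
      rw [Finset.mem_powersetCard] at hU ⊢
      refine ⟨Finset.sdiff_subset, ?_⟩
      rw [Finset.card_sdiff_of_subset hU.1]; omega
    · intro T hT
      rw [Finset.mem_powersetCard] at hT ⊢
      refine ⟨Finset.sdiff_subset, ?_⟩
      rw [Finset.card_sdiff_of_subset hT.1]; omega
    · intro U hU
      rw [Finset.mem_powersetCard] at hU
      exact Finset.sdiff_sdiff_eq_self hU.1
    · intro T hT
      rw [Finset.mem_powersetCard] at hT
      exact Finset.sdiff_sdiff_eq_self hT.1
    · intro U hU
      rfl
  rw [hre]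
  have hcs := Finset.sum_sq_le_sum_mul_sum_of_sq_le_mul (S.powersetCard r)
    (r := fun _ => Real.sqrt (∏ a ∈ S, a)) (f := fun T => ∏ a ∈ T, a) (g := fun T => ∏ a ∈ S \ T, a)
    (fun T hT => Finset.prod_nonneg (fun a ha => (hS a ((Finset.mem_powersetCard.1 hT).1 ha)).le))
    (fun T _ => Finset.prod_nonneg (fun a ha => (hS a (Finset.sdiff_subset ha)).le))
    (fun T hT => by
      rw [Real.sq_sqrt hP.le, mul_comm, Finset.prod_sdiff (Finset.mem_powersetCard.1 hT).1])
  rw [Finset.sum_const, Finset.card_powersetCard, nsmul_eq_mul, mul_pow, Real.sq_sqrt hP.le] at hcs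
  exact hcs

/-! ## §3 The SYMMETRIC PROFILE LAW for full-positive-rooted polynomials: `|a_r · a_{n−r}| ≥ C(n,r)² · |a_0 · a_n|` -/

/-- Elementary symmetric functions of the root multiset of a full-positive-rooted polynomial as sums over `r`-subsets of
its root SET. [folklore] -/
theorem esymm_roots_eq {q : ℝ[X]} (h : IsFullPosRooted q) (j : ℕ) :
    q.roots.esymm j = ∑ T ∈ q.roots.toFinset.powersetCard j, ∏ a ∈ T, a := by
  conv_lhs => rw [roots_eq_toFinset_val_of_fullPos h, ← Multiset.map_id q.roots.toFinset.val]
  rw [Finset.esymm_map_val]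
  rfl

/-- Vieta read in absolute value: `|a_k| = |lc| · e_{n−k}(roots)` for a full-positive-rooted polynomial. [folklore] -/
theorem abs_coeff_eq {q : ℝ[X]} (h : IsFullPosRooted q) {k : ℕ} (hk : k ≤ q.natDegree) :
    |q.coeff k| = |q.leadingCoeff| * ∑ T ∈ q.roots.toFinset.powersetCard (q.natDegree - k), ∏ a ∈ T, a := by
  rw [coeff_eq_esymm_roots_of_card (card_roots_of_fullPos h) hk, esymm_roots_eq h, abs_mul, abs_mul,
    abs_pow, abs_neg, abs_one, one_pow, mul_one]
  congr 1
  exact abs_of_nonneg (Finset.sum_nonneg (fun T hT => Finset.prod_nonneg (fun a ha =>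
    (roots_pos_of_fullPos h a (Multiset.mem_toFinset.1 ((Finset.mem_powersetCard.1 hT).1 ha))).le)))

/-- **Symmetric profile law.** If `q` has `natDegree q = n` distinct positive roots then for every `r ≤ n`
`C(n,r)² · |a_0 · a_n| ≤ |a_r · a_{n−r}|` (equality at `c(X−1)^n`). [folklore; Newton–Maclaurin endpoint case] -/
theorem profileLaw_fullPos (q : ℝ[X]) (h : IsFullPosRooted q) {r : ℕ} (hr : r ≤ q.natDegree) :
    ((q.natDegree.choose r : ℕ) : ℝ) ^ 2 * |q.coeff 0 * q.leadingCoeff|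
      ≤ |q.coeff r * q.coeff (q.natDegree - r)| := by
  set S := q.roots.toFinset with hSdef
  have hS : ∀ a ∈ S, 0 < a := fun a ha => roots_pos_of_fullPos h a (Multiset.mem_toFinset.1 ha)
  have hcard : S.card = q.natDegree := toFinset_card_roots_of_fullPos h
  have key := choose_sq_mul_prod_le S hS (r := r) (by rw [hcard]; exact hr)
  rw [hcard] at key
  have h0 : |q.coeff 0| = |q.leadingCoeff| * ∏ a ∈ S, a := by
    rw [abs_coeff_eq h (Nat.zero_le _), Nat.sub_zero, ← hcard, Finset.powersetCard_self, Finset.sum_singleton]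
  have hr' : |q.coeff r| = |q.leadingCoeff| * ∑ T ∈ S.powersetCard (q.natDegree - r), ∏ a ∈ T, a :=
    abs_coeff_eq h hr
  have hnr : |q.coeff (q.natDegree - r)|
      = |q.leadingCoeff| * ∑ T ∈ S.powersetCard r, ∏ a ∈ T, a := by
    rw [abs_coeff_eq h (Nat.sub_le _ _), Nat.sub_sub_self hr]
  have hlc : 0 ≤ |q.leadingCoeff| := abs_nonneg _
  rw [abs_mul, abs_mul, h0, hr', hnr]
  calc ((q.natDegree.choose r : ℕ) : ℝ) ^ 2 * (|q.leadingCoeff| * (∏ a ∈ S, a) * |q.leadingCoeff|)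
      = |q.leadingCoeff| * |q.leadingCoeff| * (((q.natDegree.choose r : ℕ) : ℝ) ^ 2 * ∏ a ∈ S, a) := by ring
    _ ≤ |q.leadingCoeff| * |q.leadingCoeff| * ((∑ T ∈ S.powersetCard r, ∏ a ∈ T, a)
          * (∑ U ∈ S.powersetCard (q.natDegree - r), ∏ a ∈ U, a)) :=
        mul_le_mul_of_nonneg_left key (mul_nonneg hlc hlc)
    _ = _ := by ring

/-! ## §4 Coefficient heights of a pencil determinant see the design's REPRESENTATION NUMBERS (`…FiniteSectorHeightDefs.Rrep`) -/

/-- The `(a,b)` entry of the pencil is `Σ_l X^{d l} · C (S_l a b)`. [folklore] -/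
theorem pencil_apply {m K : ℕ} (d : Fin K → ℕ) (S : Fin K → Matrix (Fin m) (Fin m) ℝ) (a b : Fin m) :
    pencil d S a b = ∑ l, X ^ d l * C (S l a b) := by
  simp only [pencil, Matrix.sum_apply, Matrix.smul_apply, Matrix.map_apply, smul_eq_mul]

/-- A permutation product of pencil entries, expanded over letter choices `λ : Fin m → Fin K`. [folklore] -/
theorem prod_pencil_apply {m K : ℕ} (d : Fin K → ℕ) (S : Fin K → Matrix (Fin m) (Fin m) ℝ)
    (σ : Equiv.Perm (Fin m)) :
    ∏ i, pencil d S (σ i) i = ∑ lam : Fin m → Fin K, X ^ (∑ i, d (lam i)) * C (∏ i, S (lam i) (σ i) i) := by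
  simp_rw [pencil_apply]
  rw [Finset.prod_univ_sum (fun _ => Finset.univ) (fun i l => X ^ d l * C (S l (σ i) i)),
    Fintype.piFinset_univ]
  refine Finset.sum_congr rfl (fun lam _ => ?_)
  rw [Finset.prod_mul_distrib, Finset.prod_pow_eq_pow_sum, ← map_prod C]

/-- The `r`-th coefficient of a permutation product: only letter choices representing `r` contribute. [folklore] -/
theorem coeff_prod_pencil {m K : ℕ} (d : Fin K → ℕ) (S : Fin K → Matrix (Fin m) (Fin m) ℝ)
    (σ : Equiv.Perm (Fin m)) (r : ℕ) :
    (∏ i, pencil d S (σ i) i).coeff r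
      = ∑ lam : Fin m → Fin K, if r = ∑ i, d (lam i) then ∏ i, S (lam i) (σ i) i else 0 := by
  rw [prod_pencil_apply, finsetSum_coeff]
  refine Finset.sum_congr rfl (fun lam _ => ?_)
  rw [X_pow_mul, coeff_C_mul_X_pow]

/-- `|[t^r] det P| ≤ m! · h^m · R_d^{(m)}(r)` for letters bounded by `h`. [folklore: permutation expansion] -/
theorem abs_coeff_det_pencil_le {m K : ℕ} (d : Fin K → ℕ) (S : Fin K → Matrix (Fin m) (Fin m) ℝ) {h : ℝ}
    (hS : ∀ l i j, |S l i j| ≤ h) (r : ℕ) :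
    |(pencil d S).det.coeff r| ≤ (m.factorial : ℝ) * (h ^ m * Rrep d m r) := by
  rw [Matrix.det_apply', finsetSum_coeff]
  have key : ∀ σ : Equiv.Perm (Fin m),
      |((((Equiv.Perm.sign σ : ℤˣ) : ℤ) : ℝ[X]) * ∏ i, pencil d S (σ i) i).coeff r|
        ≤ h ^ m * Rrep d m r := by
    intro σ
    have hsgn : |((((Equiv.Perm.sign σ : ℤˣ) : ℤ) : ℝ[X]) * ∏ i, pencil d S (σ i) i).coeff r|
        = |(∏ i, pencil d S (σ i) i).coeff r| := by
      rcases Int.units_eq_one_or (Equiv.Perm.sign σ) with h1 | h1 <;> simp [h1]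
    rw [hsgn, coeff_prod_pencil]
    calc |∑ lam : Fin m → Fin K, (if r = ∑ i, d (lam i) then ∏ i, S (lam i) (σ i) i else 0)|
        ≤ ∑ lam : Fin m → Fin K, |if r = ∑ i, d (lam i) then ∏ i, S (lam i) (σ i) i else 0| :=
          Finset.abs_sum_le_sum_abs _ _
      _ ≤ ∑ lam : Fin m → Fin K, (if (∑ i, d (lam i)) = r then h ^ m else 0) := by
          refine Finset.sum_le_sum (fun lam _ => ?_)
          by_cases hc : (∑ i, d (lam i)) = r
          · rw [if_pos hc.symm, if_pos hc, Finset.abs_prod]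
            calc ∏ i, |S (lam i) (σ i) i| ≤ ∏ _i : Fin m, h :=
                  Finset.prod_le_prod (fun i _ => abs_nonneg _) (fun i _ => hS _ _ _)
              _ = h ^ m := by simp
          · rw [if_neg (fun h' => hc h'.symm), if_neg hc, abs_zero]
      _ = h ^ m * Rrep d m r := by
          rw [← Finset.sum_filter, Finset.sum_const, nsmul_eq_mul, mul_comm]
          simp [Rrep]
  calc |∑ σ : Equiv.Perm (Fin m),
          ((((Equiv.Perm.sign σ : ℤˣ) : ℤ) : ℝ[X]) * ∏ i, pencil d S (σ i) i).coeff r|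
      ≤ ∑ σ : Equiv.Perm (Fin m),
          |((((Equiv.Perm.sign σ : ℤˣ) : ℤ) : ℝ[X]) * ∏ i, pencil d S (σ i) i).coeff r| :=
        Finset.abs_sum_le_sum_abs _ _
    _ ≤ ∑ _σ : Equiv.Perm (Fin m), h ^ m * Rrep d m r := Finset.sum_le_sum (fun σ _ => key σ)
    _ = (m.factorial : ℝ) * (h ^ m * Rrep d m r) := by
        rw [Finset.sum_const, Finset.card_univ, Fintype.card_perm, Fintype.card_fin, nsmul_eq_mul]

/-! ## §5 THE PROFILE LAW for full-positive-rooted pencils: `C(n,r)² · |c₀ · lc| ≤ (m!)² h^{2m} · R(r) · R(n−r)` -/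

/-- **Profile law.**  A pencil with letters `≤ h` whose determinant has `n = natDegree` distinct positive roots obeys,
for every `r ≤ n`, `C(n,r)²·|c₀·lc| ≤ (m!·h^m·R(r))·(m!·h^m·R(n−r))` where `R = R_d^{(m)}` counts ordered `m`-fold
representations by the exponent design.  Summed over `r` (`Σ_r R(r) = K^m`) it returns line «range»'s count law
`2^n √|c₀·lc| ≤ m!(Kh)^m` (`…Range.heightLaw`); its strength is on THIN designs (`R` small). [folklore] -/
theorem pencilProfileLaw {m K : ℕ} (d : Fin K → ℕ) (S : Fin K → Matrix (Fin m) (Fin m) ℝ) {h : ℝ}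
    (hS : ∀ l i j, |S l i j| ≤ h) (hfull : IsFullPosRooted (pencil d S).det) {r : ℕ}
    (hr : r ≤ (pencil d S).det.natDegree) :
    (((pencil d S).det.natDegree.choose r : ℕ) : ℝ) ^ 2
        * |(pencil d S).det.coeff 0 * (pencil d S).det.leadingCoeff|
      ≤ ((m.factorial : ℝ) * (h ^ m * Rrep d m r))
        * ((m.factorial : ℝ) * (h ^ m * Rrep d m ((pencil d S).det.natDegree - r))) := by
  have h1 := profileLaw_fullPos _ hfull hr
  rw [abs_mul ((pencil d S).det.coeff r) ((pencil d S).det.coeff _)] at h1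
  exact h1.trans (mul_le_mul (abs_coeff_det_pencil_le d S hS r) (abs_coeff_det_pencil_le d S hS _)
    (abs_nonneg _) ((abs_nonneg _).trans (abs_coeff_det_pencil_le d S hS r)))

/-- `K`-FREE COROLLARY (thin designs): on a `B_m`-type design with `R(r)·R(n−r) ≤ g²` at some `r ≤ n`, a full pencil has
`C(n,r)²·|c₀·lc| ≤ (m!·h^m·g)²` — no dependence on the number of letters `K`. [folklore] -/
theorem profileLaw_thin {m K : ℕ} (d : Fin K → ℕ) (S : Fin K → Matrix (Fin m) (Fin m) ℝ) {h : ℝ}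
    (hS : ∀ l i j, |S l i j| ≤ h) (hfull : IsFullPosRooted (pencil d S).det) {r g : ℕ}
    (hr : r ≤ (pencil d S).det.natDegree)
    (hthin : Rrep d m r * Rrep d m ((pencil d S).det.natDegree - r) ≤ g ^ 2) :
    (((pencil d S).det.natDegree.choose r : ℕ) : ℝ) ^ 2
        * |(pencil d S).det.coeff 0 * (pencil d S).det.leadingCoeff|
      ≤ ((m.factorial : ℝ) * h ^ m * g) ^ 2 := by
  have h1 := pencilProfileLaw d S hS hfull hr
  have h2 : ((Rrep d m r : ℕ) : ℝ) * (Rrep d m ((pencil d S).det.natDegree - r) : ℕ) ≤ (g : ℝ) ^ 2 := by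
    exact_mod_cast hthin
  calc _ ≤ _ := h1
    _ = ((m.factorial : ℝ) * h ^ m) ^ 2
          * (((Rrep d m r : ℕ) : ℝ) * (Rrep d m ((pencil d S).det.natDegree - r) : ℕ)) := by ring
    _ ≤ ((m.factorial : ℝ) * h ^ m) ^ 2 * (g : ℝ) ^ 2 := mul_le_mul_of_nonneg_left h2 (by positivity)
    _ = _ := by ring

/-! ## §6 The row schema (`…FiniteSectorHeightDefs.ProfileRow`): one thin window decides a row -/

/-- The row `ProfileRow d H n` follows from one thin window `(r, R(r), R(n−r))` with `4·H⁴·R(r)·R(n−r) < C(n,r)²`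
(the pencil profile law at `m = 2`: `(2!·H²·R(r))·(2!·H²·R(n−r))`). [folklore] -/
theorem profileRow_of {K : ℕ} (d : Fin K → ℕ) {H : ℝ} {n r : ℕ} (hr : r ≤ n)
    (hnum : (2 * (H ^ 2 * Rrep d 2 r)) * (2 * (H ^ 2 * Rrep d 2 (n - r))) < ((n.choose r : ℕ) : ℝ) ^ 2) :
    ProfileRow d H n := by
  intro S hS hends hfull hn
  have key := pencilProfileLaw d S hS hfull (r := r) (by rw [hn]; exact hr)
  rw [hn] at key
  have h1 : ((n.choose r : ℕ) : ℝ) ^ 2 * 1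
      ≤ ((n.choose r : ℕ) : ℝ) ^ 2 * |(pencil d S).det.coeff 0 * (pencil d S).det.leadingCoeff| :=
    mul_le_mul_of_nonneg_left hends (by positivity)
  have h2 := h1.trans key
  norm_num [Nat.factorial] at h2
  linarith

/-! ## §7 The seven rows on the census's extremal stamp bases `dA5 … dA8b` (`…FiniteSectorDefs`; `Rrep` by `decide`,
binomials by `norm_num`) -/

/-- On `dA5 = (0,1,3,5,7,8)`: an integer-normalised full `2×2` pencil of degree `16 = n(2,5)` has a letter `≥ 54`
(window `r = 7`: `R(7) = 2`, `R(9) = 2`, `C(16,7) = 11440`; the design-blind row `…Range.heightStampLaw_G6` gives `≥ 31`).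
[folklore] -/
theorem profileRow_dA5 : ProfileRow dA5 53 16 := by
  refine profileRow_of dA5 (r := 7) (by norm_num) ?_
  have hsub : (16 : ℕ) - 7 = 9 := rfl
  have h1 : Rrep dA5 2 7 = 2 := by decide
  have h2 : Rrep dA5 2 9 = 2 := by decide
  have h3 : ((16 : ℕ).choose 7) = 11440 := by
    rw [Nat.choose_eq_factorial_div_factorial (by norm_num)]; norm_num [Nat.factorial]
  rw [hsub, h1, h2, h3]
  norm_num

/-- On `dA6 = (0,1,3,5,7,9,10)`: an integer-normalised full `2×2` pencil of degree `20 = n(2,6)` has a letter `≥ 205`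
(window `r = 9`: `R(9) = 2`, `R(11) = 2`, `C(20,9) = 167960`; design-blind row: `≥ 104`). [folklore] -/
theorem profileRow_dA6 : ProfileRow dA6 204 20 := by
  refine profileRow_of dA6 (r := 9) (by norm_num) ?_
  have hsub : (20 : ℕ) - 9 = 11 := rfl
  have h1 : Rrep dA6 2 9 = 2 := by decide
  have h2 : Rrep dA6 2 11 = 2 := by decide
  have h3 : ((20 : ℕ).choose 9) = 167960 := by
    rw [Nat.choose_eq_factorial_div_factorial (by norm_num)]; norm_num [Nat.factorial]
  rw [hsub, h1, h2, h3]
  norm_num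

/-- On `dA7a = (0,1,3,5,7,8,17,18)`: an integer-normalised full `2×2` pencil of degree `26 = n(2,7)` has a letter `≥ 1848`
(window `r = 12`: `R(12) = 2`, `R(14) = 1`, `C(26,12) = 9657700`; design-blind row `…Range.heightStampLaw_G8`: `≥ 725`).
[folklore] -/
theorem profileRow_dA7a : ProfileRow dA7a 1847 26 := by
  refine profileRow_of dA7a (r := 12) (by norm_num) ?_
  have hsub : (26 : ℕ) - 12 = 14 := rfl
  have h1 : Rrep dA7a 2 12 = 2 := by decide
  have h2 : Rrep dA7a 2 14 = 1 := by decide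
  have h3 : ((26 : ℕ).choose 12) = 9657700 := by
    rw [Nat.choose_eq_factorial_div_factorial (by norm_num)]; norm_num [Nat.factorial]
  rw [hsub, h1, h2, h3]
  norm_num

/-- On `dA7b = (0,1,3,4,9,10,12,13)`: an integer-normalised full `2×2` pencil of degree `26` has a letter `≥ 1390`
(window `r = 11`: `R(11) = 2`, `R(15) = 2`, `C(26,11) = 7726160`; design-blind row: `≥ 725`). [folklore] -/
theorem profileRow_dA7b : ProfileRow dA7b 1389 26 := by
  refine profileRow_of dA7b (r := 11) (by norm_num) ?_
  have hsub : (26 : ℕ) - 11 = 15 := rfl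
  have h1 : Rrep dA7b 2 11 = 2 := by decide
  have h2 : Rrep dA7b 2 15 = 2 := by decide
  have h3 : ((26 : ℕ).choose 11) = 7726160 := by
    rw [Nat.choose_eq_factorial_div_factorial (by norm_num)]; norm_num [Nat.factorial]
  rw [hsub, h1, h2, h3]
  norm_num

/-- On `dA7c = (0,1,2,5,8,11,12,13)`: an integer-normalised full `2×2` pencil of degree `26` has a letter `≥ 1390`
(window `r = 11`: `R(11) = 2`, `R(15) = 2`, `C(26,11) = 7726160`; design-blind row: `≥ 725`). [folklore] -/
theorem profileRow_dA7c : ProfileRow dA7c 1389 26 := by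
  refine profileRow_of dA7c (r := 11) (by norm_num) ?_
  have hsub : (26 : ℕ) - 11 = 15 := rfl
  have h1 : Rrep dA7c 2 11 = 2 := by decide
  have h2 : Rrep dA7c 2 15 = 2 := by decide
  have h3 : ((26 : ℕ).choose 11) = 7726160 := by
    rw [Nat.choose_eq_factorial_div_factorial (by norm_num)]; norm_num [Nat.factorial]
  rw [hsub, h1, h2, h3]
  norm_num

/-- On `dA8a = (0,1,3,5,7,9,10,21,22)`: an integer-normalised full `2×2` pencil of degree `32 = n(2,8)` has a letter `≥ 12259`
(window `r = 16`: `R(16) = 2` on both sides, `C(32,16) = 601080390`; design-blind row `…Range.heightStampLaw_G9`: `≥ 5149`).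
[folklore] -/
theorem profileRow_dA8a : ProfileRow dA8a 12258 32 := by
  refine profileRow_of dA8a (r := 16) (by norm_num) ?_
  have hsub : (32 : ℕ) - 16 = 16 := rfl
  have h1 : Rrep dA8a 2 16 = 2 := by decide
  have h3 : ((32 : ℕ).choose 16) = 601080390 := by
    rw [Nat.choose_eq_factorial_div_factorial (by norm_num)]; norm_num [Nat.factorial]
  rw [hsub, h1, h3]
  norm_num

/-- On `dA8b = (0,1,2,5,8,11,14,15,16)`: an integer-normalised full `2×2` pencil of degree `32` has a letter `≥ 10857`
(window `r = 14`: `R(14) = 2`, `R(18) = 2`, `C(32,14) = 471435600`; design-blind row: `≥ 5149`). [folklore] -/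
theorem profileRow_dA8b : ProfileRow dA8b 10856 32 := by
  refine profileRow_of dA8b (r := 14) (by norm_num) ?_
  have hsub : (32 : ℕ) - 14 = 18 := rfl
  have h1 : Rrep dA8b 2 14 = 2 := by decide
  have h2 : Rrep dA8b 2 18 = 2 := by decide
  have h3 : ((32 : ℕ).choose 14) = 471435600 := by
    rw [Nat.choose_eq_factorial_div_factorial (by norm_num)]; norm_num [Nat.factorial]
  rw [hsub, h1, h2, h3]
  norm_num

/-! ## §8 «Assume the law fails»: violating designs are ADDITIVELY RICH across the whole binomial window -/

/-- If a full-positive-rooted pencil of degree `n` exists on design `d` at height `h` with `|c₀·lc| ≥ 1`, then for every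
`r ≤ n` the symmetrised representation number dominates the binomial profile: `C(n,r) ≤ m!·h^m·max(R(r), R(n−r))`.
So a long full format at bounded height forces `max_r R ≥ C(n,⌊n/2⌋)/(m! h^m)` — high additive energy of the design —
whereas Sidon / `B_m[g]` designs carry only `n ≤ log-height` full formats, uniformly in `K`. [folklore] -/
theorem design_rich_of_full {m K : ℕ} (d : Fin K → ℕ) (S : Fin K → Matrix (Fin m) (Fin m) ℝ) {h : ℝ} (hh : 0 ≤ h)
    (hS : ∀ l i j, |S l i j| ≤ h) (hends : 1 ≤ |(pencil d S).det.coeff 0 * (pencil d S).det.leadingCoeff|)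
    (hfull : IsFullPosRooted (pencil d S).det) {r : ℕ} (hr : r ≤ (pencil d S).det.natDegree) :
    (((pencil d S).det.natDegree.choose r : ℕ) : ℝ)
      ≤ (m.factorial : ℝ) * h ^ m
        * max (Rrep d m r : ℝ) (Rrep d m ((pencil d S).det.natDegree - r) : ℝ) := by
  set M := max (Rrep d m r : ℝ) (Rrep d m ((pencil d S).det.natDegree - r) : ℝ) with hM
  have key := pencilProfileLaw d S hS hfull hr
  have hA : 0 ≤ (m.factorial : ℝ) * h ^ m := by positivity
  have h1 : (((pencil d S).det.natDegree.choose r : ℕ) : ℝ) ^ 2 ≤ ((m.factorial : ℝ) * h ^ m * M) ^ 2 := by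
    have hR1 : (Rrep d m r : ℝ) ≤ M := le_max_left _ _
    have hR2 : (Rrep d m ((pencil d S).det.natDegree - r) : ℝ) ≤ M := le_max_right _ _
    calc (((pencil d S).det.natDegree.choose r : ℕ) : ℝ) ^ 2
        = (((pencil d S).det.natDegree.choose r : ℕ) : ℝ) ^ 2 * 1 := by ring
      _ ≤ (((pencil d S).det.natDegree.choose r : ℕ) : ℝ) ^ 2
            * |(pencil d S).det.coeff 0 * (pencil d S).det.leadingCoeff| :=
          mul_le_mul_of_nonneg_left hends (by positivity)
      _ ≤ _ := key
      _ ≤ ((m.factorial : ℝ) * (h ^ m * M)) * ((m.factorial : ℝ) * (h ^ m * M)) :=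
          mul_le_mul (mul_le_mul_of_nonneg_left (mul_le_mul_of_nonneg_left hR1 (by positivity)) (by positivity))
            (mul_le_mul_of_nonneg_left (mul_le_mul_of_nonneg_left hR2 (by positivity)) (by positivity))
            (by positivity) (by positivity)
      _ = ((m.factorial : ℝ) * h ^ m * M) ^ 2 := by ring
  have hMnn : 0 ≤ (m.factorial : ℝ) * h ^ m * M := mul_nonneg hA ((Nat.cast_nonneg _).trans (le_max_left _ _))
  exact (pow_le_pow_iff_left₀ (Nat.cast_nonneg _) hMnn two_ne_zero).1 h1

end Summit.ValiantsHypothesis.ValiantsHypothesis.Theorems.LacunarySymmetroidMatrixDescartes.ProfileLaw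

end
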